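import Literature.AlgebraicGeometry.HilbertScheme.ChernCharacterOperators
import HarnessLib

/-!
# Oberdieck's transfer operators `T_Γ`: correspondences of the surface acting on `ℍ = ⨁ₙ H*(S^[n])`,
and the Lefschetz dual of a divisor class `D_α` on `S^[n]` (named facts + consequences)

Layer `Literature/AlgebraicGeometry/HilbertScheme`; sequel of `ChernCharacterOperators`.  G. Oberdieck, *A Lie
algebra action on the Chow ring of the Hilbert scheme of points of a K3 surface*, Comment. Math. Helv. 96 (2021),
§3.2 "The surface part" — "general remarks that hold for every smooth projective surface `S`": a homogeneous
correspondence `Γ ∈ A^{deg Γ}(S × S)` (acting on `A*(S)` by `Γ(γ) = π₂*(π₁*γ · Γ)`) gives the operator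
`T_Γ = −Σ_{n>0} n^{deg Γ − 3} 𝔮ₙ𝔮₋ₙ(Γ′)` on `A*(Hilb S)`, and

* **Lemma 3.4** (`k = 1`): `[T_Γ, 𝔮ₙ(γ)] = n^{deg Γ − 2} 𝔮ₙ(Γ(γ))` for `n > 0` (and the transposed formula for `n < 0`);
* **Cor. 3.5**: `[T_Γ, T_Γ̃] = T_{[Γ, Γ̃]}` — "for every `n ≥ 1` we have an embedding of Lie algebras
  `T : A*(S × S) → A*(S^[n] × S^[n])`, `Γ ↦ T_Γ`".

In the rendering of the prequels (`HeisenbergFockSpace.transferOp q C t φ`, the correspondence `Γ` replaced by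
the endomorphism `φ = Γ(·)` of `H*(S(ℂ); ℂ)` of degree `2t = 2(deg Γ − 2)`, its Künneth decomposition by a Casimir
element `C` of the Poincaré pairing, `n^{deg Γ − 3} = n^{t−1}`) both statements are identities between operators
built from an instance `𝔑 : NakajimaOperators hS H`, and they hold for EVERY instance (they follow from the
Heisenberg relations, the bi-degree axiom and cyclicity by Oberdieck's three-line computation; Poincaré duality
makes the Casimir element unique and degree-matched).  They are recorded here as named facts IN THE PRINTED
GENERALITY read in cohomology — surfaces with `H^odd(S(ℂ); ℂ) = 0`, where every class is even as in Chow (Oberdieck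
invokes "the cohomological version of Lemma 3.4" for K3, p. 7) — universally quantified over instances
(`Oberdieck2021_transfer_bracket`, `Oberdieck2021_transfer_lieHom`); the SUPER-versions for surfaces with odd
cohomology (abelian surfaces: signs of LQW (2.7)) are not printed and are support statements of the Hodge ladder, to
be proved from the axioms.  The first CONSEQUENCE is proved (for any surface, from the commutator identity as a
hypothesis): Lehn's `e_α = −Σ 𝔮ₙ𝔮₋ₙ(Δ_*α)` says that cup product with the divisor class
`D_α = G₀(α, n)` IS the transfer `T(L_α)` of the Lefschetz operator `L_α = α ∪ ·` of the surface
(`cupOperator_zero_eq_transferOp`, from `[𝔊₀(α), 𝔮ₘ] = m𝔮ₘ(α ·)` and Lemma 3.4 by cyclicity).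

## SCOPE CAVEAT (Oberdieck Rmk. 3.2 versus surfaces with `b₁ ≠ 0`)

Thm. 3.1 is stated and proved for K3 surfaces: `(e_a, f_a, h)` with `h = 2Σ_{n>0} n⁻¹ 𝔮ₙ𝔮₋ₙ(c₂ − c₁)` and
`f̃_α = −2Σ_{n>0} n⁻² 𝔮ₙ𝔮₋ₙ(α₁ + α₂)`, `f_α = f̃_α/(α,α)`.  These are `T_Γ` for the correspondences
`h_S = 2(c₂ − c₁)` and `f̃^S_α = 2(α₁ + α₂)` of the surface ((3.5)–(3.6)), which form an `𝔰𝔩₂`-triple with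
`e^S_α = Δ_*α` on `H*(S)` WHEN `H^odd(S) = 0`: `2(c₂ − c₁)` acts by `i − 2` on `Hⁱ(S)` only for `i` even, and
`2(α₁ + α₂)` kills `H³(S)`, whereas the Lefschetz dual of `α ∪ ·` on a surface must invert `α ∪ : H¹ → H³`.  Hence
Rmk. 3.2 ("for any `α ∈ H²(S, ℚ)` of non-zero square the operator `e_α` admits the Lefschetz dual `f̃_α/(α·α)`")
holds for surfaces with `b₁(S) = 0`; for an ABELIAN surface the Lefschetz dual of `e_{D_α}` on `S^[n]` is
`T(Λ^S_α)` with `Λ^S_α` the dual Lefschetz operator of `α` ON THE SURFACE (which has a component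
`H³(S) → H¹(S)`), still quadratic in Nakajima operators — this is what §3.2 (Lemma 3.4, Cor. 3.5) gives for every
`S`, and what the statements below are shaped for (`φ` an arbitrary graded endomorphism, e.g. `Λ^S_α`).
No statement of this file depends on the remark.

## Sources (read; PDF pages of the materialised text arXiv:1908.08830)

p. 6: (3.1)–(3.2) "`e_α = −Σ_{n>0} 𝔮ₙ𝔮₋ₙ(Δ_*α)` … The formulas hold also in cohomology for all `α ∈ H²(S, ℚ)`",
the displays `h`, `f̃_α`, Thm. 3.1 (a)–(c), Rmk. 3.2 (quoted above).  p. 7: §3.2 "`Γ(γ) = π₂*(π₁*(γ) · Γ)` …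
`T_Γ = −Σ_{n>0} n^{deg(Γ)−3} 𝔮ₙ𝔮₋ₙ(Γ′)`", Lemma 3.4 ("`[T_Γ, 𝔮_{n₁}⋯𝔮_{n_k}(𝒞)] = Σ_{i : nᵢ>0} nᵢ^{deg(Γ)−2}
𝔮_{n₁}⋯𝔮_{n_k}(Δ_{S^{i−1}} × Γ × Δ_{S^{k−i}}(𝒞)) + (−1)^{deg(Γ)−3} Σ_{i : nᵢ<0} nᵢ^{deg(Γ)−2} 𝔮_{n₁}⋯𝔮_{n_k}(⋯Γ′⋯)`"),
Cor. 3.5 ("`[T_Γ, T_Γ̃] = T_{[Γ,Γ̃]}` for any homogeneous correspondences"), (3.5)–(3.6) and the lines "Applying `T`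
to these correspondences precisely yields the operators (e_a), (h), (f̃_a)" and "`[h, 𝔮ₙ(u)] = (i−2)𝔮ₙ(u)` … `h`
acts on `Hʲ(S^[n])` by multiplication by `j − 2n`".

## Contents

* `shiftedPart`, `IsOfDegree φ s` (a graded endomorphism of `H*(Y; R)` of degree `s ∈ ℤ`); `totalLefschetz` has
  degree `2` (`isOfDegree_totalLefschetz`).
* NAMED FACTS `Oberdieck2021_transfer_bracket` (Lemma 3.4, `k = 1`, `n > 0`) and `Oberdieck2021_transfer_lieHom`
  (Cor. 3.5), in cohomology with `ℂ`-coefficients for surfaces with `H^odd = 0`, for every instance of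
  `NakajimaOperators` and every Casimir element of the Poincaré pairing of `S`.  Both are dischargeable by algebra
  from the axioms (no geometry).
* PROVED: `transferOp_vac` (`T(φ)|0⟩ = 0`), linearity of `T` in `φ`, and `cupOperator_zero_eq_transferOp`:
  **`𝔊₀(α) = T(L_α)`** for `α ∈ H²(S)` given the commutator identity of Lemma 3.4 for `T(L_α)` (any surface), with the
  corollary `…_of_odd_vanishing` from the named fact.

## Not here

Thm. 3.1 (c) and the `δ`-direction (`e_δ`, `f̃_δ` cubic in Nakajima operators; needs `K = 0` AND `e(S) = 24`);
Thm. 1.1 (the lift to Chow); the monodromy application §1.2; the identification `T(h_S)|_{ℍₙ} = h_{S^[n]}` and the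
`𝔰𝔩₂`-triple `(𝔊₀(α), h, T(Λ^S_α))` on `H*(S^[n])` (consequences of the two facts, to be proved in a sequel).
-/

noncomputable section

open DirectSum CategoryTheory TensorProduct
open Literature.AlgebraicTopology.SingularHomology
open Literature.AlgebraicGeometry.Motives (SchemeOver ComplexPoints IsSmoothProjective)
open Literature.AlgebraicGeometry.Hyperkaehler (totalCohomology ofDegree totalCup totalLefschetz)
open Literature.AlgebraicGeometry.HodgeTheory (complexBetti)

namespace Literature.AlgebraicGeometry.HilbertScheme

/-! ### Graded endomorphisms of `H*(Y; R)` -/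

section Degree

universe u v

variable (R : Type v) [CommRing R] (Y : Type u) [TopologicalSpace Y]

/-- The summand `H^{k+s}(Y; R) ⊆ H*(Y; R)` for `k ∈ ℕ`, `s ∈ ℤ` (`⊥` when `k + s < 0`).
[cite: Oberdieck2021, §3.2 p. 7 ("deg(Γ)")] -/
def shiftedPart (k : ℕ) (s : ℤ) : Submodule R (totalCohomology R Y) :=
  if 0 ≤ (k : ℤ) + s then LinearMap.range (ofDegree R Y ((k : ℤ) + s).toNat) else ⊥

/-- **`φ ∈ End(H*(Y; R))` is graded of degree `s`**: `φ(Hᵏ) ⊆ H^{k+s}` for all `k` (`= 0` if `k + s < 0`) — the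
endomorphism induced by a homogeneous correspondence `Γ ∈ H^{2 dim Y + s}(Y × Y)`.
[cite: Oberdieck2021, §3.2 p. 7] -/
def IsOfDegree (φ : Module.End R (totalCohomology R Y)) (s : ℤ) : Prop :=
  ∀ (k : ℕ) (x : singularCohomology R R Y k), φ (ofDegree R Y k x) ∈ shiftedPart R Y k s

variable {R Y}

/-- For a non-negative shift `s ∈ ℕ` the shifted part is `H^{k+s}`. [cite: Oberdieck2021, §3.2 p. 7] -/
theorem shiftedPart_natCast (k s : ℕ) : shiftedPart R Y k (s : ℤ) = LinearMap.range (ofDegree R Y (k + s)) := by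
  rw [shiftedPart, if_pos (by positivity)]
  rfl

/-- **The Lefschetz operator `L_a = a ∪ ·` of `a ∈ H²(Y; R)` has degree `2`.** [cite: LooijengaLunts1997, §1 p. 4] -/
theorem isOfDegree_totalLefschetz (a : singularCohomology R R Y 2) : IsOfDegree R Y (totalLefschetz a) 2 := by
  intro k x
  rw [show (2 : ℤ) = ((2 : ℕ) : ℤ) from rfl, shiftedPart_natCast, Hyperkaehler.totalLefschetz_lof]
  exact LinearMap.mem_range_self _ _

/-- A scalar multiple of a graded endomorphism is graded of the same degree. [cite: Oberdieck2021, §3.2 p. 7] -/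
theorem IsOfDegree.smul {φ : Module.End R (totalCohomology R Y)} {s : ℤ} (hφ : IsOfDegree R Y φ s) (c : R) :
    IsOfDegree R Y (c • φ) s :=
  fun k x ↦ by simpa only [LinearMap.smul_apply] using Submodule.smul_mem _ c (hφ k x)

/-- A sum of graded endomorphisms of the same degree is graded of that degree. [cite: Oberdieck2021, §3.2 p. 7] -/
theorem IsOfDegree.add {φ ψ : Module.End R (totalCohomology R Y)} {s : ℤ} (hφ : IsOfDegree R Y φ s)
    (hψ : IsOfDegree R Y ψ s) : IsOfDegree R Y (φ + ψ) s :=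
  fun k x ↦ by simpa only [LinearMap.add_apply] using Submodule.add_mem _ (hφ k x) (hψ k x)

end Degree

/-! ### Formal properties of the transfer operators (proved) -/

section Formal

universe u v w

variable {K : Type u} [Field K] {Φ : ℕ → ℕ → Type w} [∀ n i, AddCommGroup (Φ n i)] [∀ n i, Module K (Φ n i)]
variable {V : Type v} [AddCommGroup V] [Module K V]

/-- The transfer term `Σᵢ 𝔮ₙ(φεᵢ)𝔮₋ₙ(eᵢ)` is additive in `φ`. [cite: Oberdieck2021, §3.2 p. 7] -/
theorem transferTerm_add (q : ℤ → V →ₗ[K] Module.End K (Fock Φ)) (C : V ⊗[K] V) (φ ψ : V →ₗ[K] V) (n : ℤ) :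
    transferTerm K q C (φ + ψ) n = transferTerm K q C φ n + transferTerm K q C ψ n := by
  induction C using TensorProduct.induction_on with
  | zero => simp [transferTerm]
  | tmul e ε => simp [transferTerm_tmul, add_mul]
  | add x y hx hy =>
    simp only [transferTerm, map_add] at hx hy ⊢
    rw [hx, hy]
    abel

/-- The transfer term is homogeneous in `φ`. [cite: Oberdieck2021, §3.2 p. 7] -/
theorem transferTerm_smul (q : ℤ → V →ₗ[K] Module.End K (Fock Φ)) (C : V ⊗[K] V) (c : K) (φ : V →ₗ[K] V)
    (n : ℤ) : transferTerm K q C (c • φ) n = c • transferTerm K q C φ n := by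
  induction C using TensorProduct.induction_on with
  | zero => simp [transferTerm]
  | tmul e ε => simp [transferTerm_tmul]
  | add x y hx hy =>
    simp only [transferTerm, map_add] at hx hy ⊢
    rw [hx, hy, smul_add]

/-- `T(φ)` is additive in `φ`. [cite: Oberdieck2021, §3.2 p. 7 ("We define f̃_a … by linearity in a")] -/
theorem transferOp_add (q : ℤ → V →ₗ[K] Module.End K (Fock Φ)) (C : V ⊗[K] V) (t : ℤ) (φ ψ : V →ₗ[K] V) :
    transferOp K q C t (φ + ψ) = transferOp K q C t φ + transferOp K q C t ψ := by
  refine DirectSum.linearMap_ext K fun p ↦ LinearMap.ext fun x ↦ ?_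
  simp only [LinearMap.coe_comp, Function.comp_apply, LinearMap.add_apply]
  rw [show (lof K ℕ (fun n ↦ FockSummand Φ n) p) x = Fock.ofSummand K Φ p x from rfl,
    transferOp_apply_ofSummand, transferOp_apply_ofSummand, transferOp_apply_ofSummand, ← neg_add,
    ← Finset.sum_add_distrib]
  congr 1
  refine Finset.sum_congr rfl fun n _ ↦ ?_
  rw [transferTerm_add, LinearMap.add_apply, smul_add]

/-- `T(φ)` is homogeneous in `φ`. [cite: Oberdieck2021, §3.2 p. 7] -/
theorem transferOp_smul (q : ℤ → V →ₗ[K] Module.End K (Fock Φ)) (C : V ⊗[K] V) (t : ℤ) (c : K) (φ : V →ₗ[K] V) :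
    transferOp K q C t (c • φ) = c • transferOp K q C t φ := by
  refine DirectSum.linearMap_ext K fun p ↦ LinearMap.ext fun x ↦ ?_
  simp only [LinearMap.coe_comp, Function.comp_apply, LinearMap.smul_apply]
  rw [show (lof K ℕ (fun n ↦ FockSummand Φ n) p) x = Fock.ofSummand K Φ p x from rfl,
    transferOp_apply_ofSummand, transferOp_apply_ofSummand, smul_neg, Finset.smul_sum]
  congr 1
  refine Finset.sum_congr rfl fun n _ ↦ ?_
  rw [transferTerm_smul, LinearMap.smul_apply, smul_comm]

variable {A : ℕ → Type v} [∀ i, AddCommGroup (A i)] [∀ i, Module K (A i)]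

/-- **`T(φ)` kills the vacuum** (every term ends in an annihilation operator `𝔮₋ₙ`, `n ≥ 1`).
[cite: Oberdieck2021, §3.2 p. 7] [cite: Lehn1999, §2.2 p. 8] -/
theorem transferOp_vac {B : (⨁ i, A i) →ₗ[K] (⨁ i, A i) →ₗ[K] K} {q : ℤ → (⨁ i, A i) →ₗ[K] Module.End K (Fock Φ)}
    {vac : Fock Φ} (h : IsHeisenbergRepresentation B q vac) (C : (⨁ i, A i) ⊗[K] (⨁ i, A i)) (t : ℤ)
    (φ : (⨁ i, A i) →ₗ[K] (⨁ i, A i)) : transferOp K q C t φ vac = 0 := by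
  -- the vacuum lies in the summand `ℍ₀`, where `T(φ)` is the empty sum
  have hvac := h.vac_mem
  rw [show ((0 : ℤ)) = ((0 : ℕ) : ℤ) from rfl, bidegPart_natCast] at hvac
  obtain ⟨x, hx⟩ := hvac
  rw [← hx, show Fock.of K Φ 0 0 x = Fock.ofSummand K Φ 0 (lof K ℕ (Φ 0) 0 x) from rfl,
    transferOp_apply_ofSummand]
  simp

end Formal

/-! ### Oberdieck's Lemma 3.4 and Corollary 3.5 (named facts, cohomological form) -/

variable {S : SchemeOver ℂ}

/-- **Oberdieck, Lemma 3.4 (`k = 1`, `n > 0`): `[T_Γ, 𝔮ₙ(γ)] = n^{deg Γ − 2} 𝔮ₙ(Γ(γ))`.**  For every smooth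
projective surface `S`, every instance `𝔑` of Nakajima's operators, every Casimir element `C` of the Poincaré
pairing of `S` (unique, by Poincaré duality) and every graded endomorphism `φ` of `H*(S(ℂ); ℂ)` of degree `2t`
(`φ = Γ(·)`, `t = deg Γ − 2`): `T(φ) 𝔮ₘ(γ) − 𝔮ₘ(γ) T(φ) = mᵗ · 𝔮ₘ(φ γ)` for all `m > 0`, `γ ∈ H*(S)`, where
`T(φ) = transferOp ℂ 𝔑.q C t φ = −Σ_{n>0} n^{t−1} Σᵢ 𝔮ₙ(φεᵢ)𝔮₋ₙ(eᵢ)` (an even operator, so the bracket is the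
commutator).  PRINTED GENERALITY: in Chow (even classes) for every smooth projective surface, and "the
cohomological version of Lemma 3.4" for K3 surfaces (p. 7) — recorded here in cohomology for surfaces with
`H^odd(S(ℂ); ℂ) = 0` (every class even, as in Chow; K3, regular surfaces with `b₁ = 0`).  The super-version for
surfaces with odd cohomology (abelian surfaces) needs the sign bookkeeping of LQW (2.7) and is NOT printed: it is a
Summits-side support statement of the Hodge ladder, to be proved from the axioms of `NakajimaOperators`.
[cite: Oberdieck2021, §3.2 Lemma 3.4 (p. 7)] -/
def Oberdieck2021_transfer_bracket : Prop :=
  ∀ ⦃S : SchemeOver ℂ⦄ (hS : IsSmoothProjective 2 S), (∀ k : ℕ, Odd k → ∀ x : complexBetti S k, x = 0) →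
    ∀ (H : HilbertSchemesOfPoints S) (𝔑 : NakajimaOperators hS H)
    (C : totalCohomology ℂ (ComplexPoints S) ⊗[ℂ] totalCohomology ℂ (ComplexPoints S)),
    IsCasimir ℂ (poincarePairing hS) C →
    ∀ (t : ℤ) (φ : Module.End ℂ (totalCohomology ℂ (ComplexPoints S))), IsOfDegree ℂ (ComplexPoints S) φ (2 * t) →
    ∀ (m : ℤ), 0 < m → ∀ γ : totalCohomology ℂ (ComplexPoints S),
      transferOp ℂ 𝔑.q C t φ * 𝔑.q m γ - 𝔑.q m γ * transferOp ℂ 𝔑.q C t φ = ((m : ℂ) ^ t) • 𝔑.q m (φ γ)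

/-- **Oberdieck, Cor. 3.5: `[T_Γ, T_Γ̃] = T_{[Γ, Γ̃]}`** — `Γ ↦ T_Γ` is a homomorphism of Lie algebras from the
homogeneous correspondences of `S` (composition bracket) to `End(ℍ)`: for graded endomorphisms `φ`, `ψ` of
`H*(S(ℂ); ℂ)` of degrees `2t`, `2t′`, `T(φ)T(ψ) − T(ψ)T(φ) = T(φψ − ψφ)` (the latter of degree `2(t+t′)`), for every
instance of Nakajima's operators and every Casimir element of the Poincaré pairing — in cohomology for surfaces with
`H^odd(S(ℂ); ℂ) = 0` (printed: Chow, any `S`; cohomology, K3); the super-version is a support statement of the Hodge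
ladder (see `Oberdieck2021_transfer_bracket`). [cite: Oberdieck2021, §3.2 Cor. 3.5 (p. 7)] -/
def Oberdieck2021_transfer_lieHom : Prop :=
  ∀ ⦃S : SchemeOver ℂ⦄ (hS : IsSmoothProjective 2 S), (∀ k : ℕ, Odd k → ∀ x : complexBetti S k, x = 0) →
    ∀ (H : HilbertSchemesOfPoints S) (𝔑 : NakajimaOperators hS H)
    (C : totalCohomology ℂ (ComplexPoints S) ⊗[ℂ] totalCohomology ℂ (ComplexPoints S)),
    IsCasimir ℂ (poincarePairing hS) C →
    ∀ (t t' : ℤ) (φ ψ : Module.End ℂ (totalCohomology ℂ (ComplexPoints S))),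
      IsOfDegree ℂ (ComplexPoints S) φ (2 * t) → IsOfDegree ℂ (ComplexPoints S) ψ (2 * t') →
      transferOp ℂ 𝔑.q C t φ * transferOp ℂ 𝔑.q C t' ψ - transferOp ℂ 𝔑.q C t' ψ * transferOp ℂ 𝔑.q C t φ =
        transferOp ℂ 𝔑.q C (t + t') (φ * ψ - ψ * φ)

/-! ### Consequence: Lehn's formula `e_α = T(L_α)` -/

namespace ChernCharacterOperators

variable {hS : IsSmoothProjective 2 S} {H : HilbertSchemesOfPoints S}

/-- The axiom `[𝔊₀(γ), 𝔮ₘ(β)] = m 𝔮ₘ(γβ)` for an EVEN class `γ` (e.g. `γ ∈ H²(S)`), as an ordinary commutator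
and for arbitrary (inhomogeneous) `β`. [cite: LiQinWang2002, Thm. 5.13 (iv) p. 13] -/
theorem cupOperator_zero_commute (𝔊 : ChernCharacterOperators hS H) {s : ℕ} (hs : Even s) (γ : complexBetti S s)
    (m : ℤ) (v : totalCohomology ℂ (ComplexPoints S)) :
    𝔊.cupOperator 0 (ofDegree ℂ (ComplexPoints S) s γ) * 𝔊.q m v -
        𝔊.q m v * 𝔊.cupOperator 0 (ofDegree ℂ (ComplexPoints S) s γ) =
      (m : ℂ) • 𝔊.q m (totalCup ℂ (ComplexPoints S) (ofDegree ℂ (ComplexPoints S) s γ) v) := by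
  induction v using DirectSum.induction_on with
  | zero => simp only [map_zero, mul_zero, zero_mul, smul_zero]; abel
  | of j β =>
    rw [← DirectSum.lof_eq_of ℂ]
    have h := 𝔊.G_zero_bracket s γ m j β
    rw [superBracket_of_even_left _ _ hs] at h
    exact h
  | add v w hv hw =>
    simp only [map_add, mul_add, add_mul, smul_add] at hv hw ⊢
    rw [← hv, ← hw]
    abel

/-- **Lehn's formula as an identity of operators: `𝔊₀(α) = T(L_α)`** — cup product with the divisor classes
`D_α = G₀(α, n)`, `α ∈ H²(S(ℂ); ℂ)`, on all `H*(S^[n])` is the transfer of the Lefschetz operator `L_α = α ∪ ·` of the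
surface ("`e_α = −Σ_{n>0} 𝔮ₙ𝔮₋ₙ(Δ_*α)` … by the results of Lehn"; `T` applied to `e_α = Δ_*(α)` "precisely
yields" `e_α`), for every instance and every `C`, GIVEN the commutator identity of Lemma 3.4 for `T(L_α)` (hypothesis
`hT`; supplied by `Oberdieck2021_transfer_bracket` when `H^odd(S) = 0`, by its super-version in general): both sides
kill the vacuum and have the commutator `m · 𝔮ₘ(α ∪ ·)` with every creation operator, so they agree by cyclicity.
[cite: Oberdieck2021, §3.1 (3.1) and §3.2 (3.5) (pp. 6–7)] [cite: LiQinWang2002, Thm. 5.13 (iv)] -/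
theorem cupOperator_zero_eq_transferOp (𝔊 : ChernCharacterOperators hS H)
    (C : totalCohomology ℂ (ComplexPoints S) ⊗[ℂ] totalCohomology ℂ (ComplexPoints S)) (α : complexBetti S 2)
    (hT : ∀ (m : ℤ), 0 < m → ∀ γ : totalCohomology ℂ (ComplexPoints S),
      transferOp ℂ 𝔊.q C 1 (totalLefschetz α) * 𝔊.q m γ - 𝔊.q m γ * transferOp ℂ 𝔊.q C 1 (totalLefschetz α) =
        ((m : ℂ) ^ (1 : ℤ)) • 𝔊.q m (totalLefschetz α γ)) :
    𝔊.cupOperator 0 (ofDegree ℂ (ComplexPoints S) 2 α) = transferOp ℂ 𝔊.q C 1 (totalLefschetz α) := by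
  refine 𝔊.ext_of_commute ?_ ?_
  · rw [𝔊.cupOperator_vacuum, transferOp_vac 𝔊.isHeisenberg]
  · intro m hm v
    rw [𝔊.cupOperator_zero_commute (by decide) α m v, hT m hm v, zpow_one, Hyperkaehler.totalLefschetz_eq_totalCup]

/-- `𝔊₀(α) = T(L_α)` for surfaces with `H^odd = 0`, from the named fact `Oberdieck2021_transfer_bracket`.
[cite: Oberdieck2021, §3.2 (3.5) and Lemma 3.4 (p. 7)] -/
theorem cupOperator_zero_eq_transferOp_of_odd_vanishing (hOb : Oberdieck2021_transfer_bracket)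
    (hreg : ∀ k : ℕ, Odd k → ∀ x : complexBetti S k, x = 0) (𝔊 : ChernCharacterOperators hS H)
    {C : totalCohomology ℂ (ComplexPoints S) ⊗[ℂ] totalCohomology ℂ (ComplexPoints S)}
    (hC : IsCasimir ℂ (poincarePairing hS) C) (α : complexBetti S 2) :
    𝔊.cupOperator 0 (ofDegree ℂ (ComplexPoints S) 2 α) = transferOp ℂ 𝔊.q C 1 (totalLefschetz α) :=
  𝔊.cupOperator_zero_eq_transferOp C α fun m hm γ ↦
    hOb hS hreg H 𝔊.toNakajimaOperators C hC 1 (totalLefschetz α)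
      (by simpa using isOfDegree_totalLefschetz (R := ℂ) α) m hm γ

end ChernCharacterOperators

end Literature.AlgebraicGeometry.HilbertScheme

end
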